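import Mathlib
import HarnessLib

/-!
# BalabanIR engine `BirComplexStableXY` (stmt-HubbardSuperconductivity-2080): chain kernels of a
Hermitian two-slice transfer kernel

Support lemmas for crux 2 of route BalabanIR (`--supports stmt-HubbardSuperconductivity-2080`),
abstract part.  For a window of temporal range two (`r = 2`) the complex Boltzmann weight of the
engine factorises over consecutive time slices, `exp (-A θ) = ∏_τ k (θ_τ, θ_{τ+1})`, with a
continuous, bounded, nowhere-vanishing two-slice kernel `k` on the slice configuration space
`X = (ι → ℝ)`; under the time-reflection reality hypothesis (R) of the item record the kernel is
HERMITIAN, `k b a = conj (k a b)`.  This file develops, for such a kernel and a finite measure `μ`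
on `X`, the calculus of the chain kernels

  `G 0 = k`,  `G (n+1) a b = ∫ G n a c * k c b dμ(c)`     (the kernels of the powers `T^(n+1)`)

WITHOUT any operator theory: bounds and joint continuity (`birChain_norm_le`, `birChain_continuous`),
the semigroup law `G (m+n+1) a b = ∫ G m a c * G n c b` (`birChain_add`, Fubini), Hermiticity
`G n b a = conj (G n a b)` (`birChain_herm`), the diagonal identity
`G (2n+1) a a = ∫ ‖G n a c‖² dμ(c)` (`birChain_diag_eq`) and — the point — STRICT POSITIVITY of the
odd diagonal `0 < Re G (2n+1) a a` at every point whose open neighbourhoods have positive mass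
(`birChain_diag_re_pos`; a doubling chain `G 1 → G 3 → G 7 → …` plus propagation of a.e. vanishing
through the semigroup law).  The companion file `BalabanIRBirComplexStableXYEvenPositivity.lean`
turns this into `Z > 0` for the typed partition function at even temporal extent.

The chain kernels are passed as a family `G` together with its two defining equations
(`hG0`, `hGs`), so that no definition is introduced here.
-/

namespace Summit.HubbardSuperconductivity.HubbardSuperconductivity.Theorems

open scoped BigOperators ComplexConjugate
open MeasureTheory

section ChainKernel

variable {ι : Type*} [Fintype ι] {μ : Measure (ι → ℝ)} [IsFiniteMeasure μ]
  {k : (ι → ℝ) → (ι → ℝ) → ℂ} {G : ℕ → (ι → ℝ) → (ι → ℝ) → ℂ} {R : ℝ}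

omit [Fintype ι] [IsFiniteMeasure μ] in
/-- A uniform bound on the kernel is nonnegative. -/
theorem birKernel_bound_nonneg (hR : ∀ a b, ‖k a b‖ ≤ R) : 0 ≤ R :=
  (norm_nonneg _).trans (hR 0 0)

omit [Fintype ι] in
/-- Uniform bound on the chain kernels: `‖G n a b‖ ≤ R^(n+1) · μ(X)^n`. -/
theorem birChain_norm_le (hR : ∀ a b, ‖k a b‖ ≤ R) (hG0 : ∀ a b, G 0 a b = k a b)
    (hGs : ∀ n a b, G (n + 1) a b = ∫ c, G n a c * k c b ∂μ) :
    ∀ n a b, ‖G n a b‖ ≤ R ^ (n + 1) * (μ.real Set.univ) ^ n := by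
  intro n
  induction n with
  | zero => intro a b; simpa [hG0] using hR a b
  | succ n ih =>
    intro a b
    rw [hGs n a b]
    have hbound : ∀ c, ‖G n a c * k c b‖ ≤ R ^ (n + 1) * (μ.real Set.univ) ^ n * R := by
      intro c
      rw [norm_mul]
      exact mul_le_mul (ih a c) (hR c b) (norm_nonneg _)
        (by positivity [birKernel_bound_nonneg hR])
    calc ‖∫ c, G n a c * k c b ∂μ‖
        ≤ R ^ (n + 1) * (μ.real Set.univ) ^ n * R * μ.real Set.univ :=
          norm_integral_le_of_norm_le_const (Filter.Eventually.of_forall hbound)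
      _ = R ^ (n + 1 + 1) * (μ.real Set.univ) ^ (n + 1) := by ring

/-- Joint continuity of the chain kernels `(a, b) ↦ G n a b` (dominated convergence, the kernel
being continuous and bounded and the measure finite). -/
theorem birChain_continuous (hk : Continuous (Function.uncurry k)) (hR : ∀ a b, ‖k a b‖ ≤ R)
    (hG0 : ∀ a b, G 0 a b = k a b) (hGs : ∀ n a b, G (n + 1) a b = ∫ c, G n a c * k c b ∂μ) :
    ∀ n, Continuous (fun p : (ι → ℝ) × (ι → ℝ) => G n p.1 p.2) := by
  intro n
  induction n with
  | zero =>
    have h : (fun p : (ι → ℝ) × (ι → ℝ) => G 0 p.1 p.2) = Function.uncurry k := by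
      funext p; rw [hG0]; rfl
    rw [h]; exact hk
  | succ n ih =>
    have h : (fun p : (ι → ℝ) × (ι → ℝ) => G (n + 1) p.1 p.2) =
        fun p => ∫ c, G n p.1 c * k c p.2 ∂μ := by
      funext p; exact hGs n p.1 p.2
    rw [h]
    refine continuous_of_dominated (bound := fun _ => R ^ (n + 1) * (μ.real Set.univ) ^ n * R)
      ?_ ?_ (integrable_const _) ?_
    · intro p
      refine Continuous.aestronglyMeasurable ?_
      exact (ih.comp (continuous_const.prodMk continuous_id)).mul
        (hk.comp (continuous_id.prodMk continuous_const))
    · intro p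
      refine Filter.Eventually.of_forall fun c => ?_
      rw [norm_mul]
      exact mul_le_mul (birChain_norm_le hR hG0 hGs n p.1 c) (hR c p.2) (norm_nonneg _)
        (by positivity [birKernel_bound_nonneg hR])
    · refine Filter.Eventually.of_forall fun c => ?_
      exact (ih.comp (continuous_fst.prodMk continuous_const)).mul
        (hk.comp (continuous_const.prodMk continuous_snd))

/-- **Semigroup law** of the chain kernels (the kernel of `T^(m+1) T^(n+1)`):
`G (m+n+1) a b = ∫ G m a c * G n c b dμ(c)` (Fubini on the finite measure `μ ⊗ μ`). -/
theorem birChain_add (hk : Continuous (Function.uncurry k)) (hR : ∀ a b, ‖k a b‖ ≤ R)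
    (hG0 : ∀ a b, G 0 a b = k a b) (hGs : ∀ n a b, G (n + 1) a b = ∫ c, G n a c * k c b ∂μ) :
    ∀ m n a b, G (m + n + 1) a b = ∫ c, G m a c * G n c b ∂μ := by
  intro m n
  induction n with
  | zero => intro a b; simpa [hG0] using hGs m a b
  | succ n ih =>
    intro a b
    have hcont := birChain_continuous hk hR hG0 hGs
    -- integrability of `(d, c) ↦ G m a c * (G n c d * k d b)` on `μ ⊗ μ`
    have hint : Integrable (Function.uncurry fun d c => G m a c * (G n c d * k d b)) (μ.prod μ) := by
      refine Integrable.of_bound ?_ (R ^ (m + 1) * (μ.real Set.univ) ^ m *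
        (R ^ (n + 1) * (μ.real Set.univ) ^ n * R)) (Filter.Eventually.of_forall ?_)
      · refine Continuous.aestronglyMeasurable ?_
        refine ((hcont m).comp (continuous_const.prodMk continuous_snd)).mul
          (((hcont n).comp (continuous_snd.prodMk continuous_fst)).mul
            (hk.comp (continuous_fst.prodMk continuous_const)))
      · rintro ⟨d, c⟩
        simp only [Function.uncurry_apply_pair]
        rw [norm_mul, norm_mul]
        have h0 := birKernel_bound_nonneg hR
        refine mul_le_mul (birChain_norm_le hR hG0 hGs m a c) ?_ (by positivity) (by positivity)
        exact mul_le_mul (birChain_norm_le hR hG0 hGs n c d) (hR d b) (norm_nonneg _)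
          (by positivity)
    calc G (m + (n + 1) + 1) a b
        = ∫ d, G (m + n + 1) a d * k d b ∂μ := hGs (m + n + 1) a b
      _ = ∫ d, ∫ c, G m a c * (G n c d * k d b) ∂μ ∂μ := by
          refine integral_congr_ae (Filter.Eventually.of_forall fun d => ?_)
          show G (m + n + 1) a d * k d b = ∫ c, G m a c * (G n c d * k d b) ∂μ
          rw [ih a d, ← integral_mul_const]
          refine integral_congr_ae (Filter.Eventually.of_forall fun c => ?_)
          show G m a c * G n c d * k d b = G m a c * (G n c d * k d b)
          ring
      _ = ∫ c, ∫ d, G m a c * (G n c d * k d b) ∂μ ∂μ := integral_integral_swap hint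
      _ = ∫ c, G m a c * G (n + 1) c b ∂μ := by
          refine integral_congr_ae (Filter.Eventually.of_forall fun c => ?_)
          show ∫ d, G m a c * (G n c d * k d b) ∂μ = G m a c * G (n + 1) c b
          rw [integral_const_mul, hGs n c b]

/-- **Hermiticity** of the chain kernels: if `k b a = conj (k a b)` then
`G n b a = conj (G n a b)` for every `n`. -/
theorem birChain_herm (hk : Continuous (Function.uncurry k)) (hR : ∀ a b, ‖k a b‖ ≤ R)
    (hG0 : ∀ a b, G 0 a b = k a b) (hGs : ∀ n a b, G (n + 1) a b = ∫ c, G n a c * k c b ∂μ)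
    (hherm : ∀ a b, k b a = conj (k a b)) :
    ∀ n a b, G n b a = conj (G n a b) := by
  intro n
  induction n with
  | zero => intro a b; rw [hG0, hG0, hherm]
  | succ n ih =>
    intro a b
    have h1 : G (n + 1) a b = ∫ c, k a c * G n c b ∂μ := by
      have := birChain_add hk hR hG0 hGs 0 n a b
      rw [Nat.zero_add] at this
      rw [this]
      refine integral_congr_ae (Filter.Eventually.of_forall fun c => ?_)
      show G 0 a c * G n c b = k a c * G n c b
      rw [hG0]
    rw [hGs n b a, h1, ← integral_conj]
    refine integral_congr_ae (Filter.Eventually.of_forall fun c => ?_)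
    show G n b c * k c a = conj (k a c * G n c b)
    rw [map_mul, ih c b, hherm a c, mul_comm]

/-- **Diagonal identity**: `G (2n+1) a a = ∫ ‖G n a c‖² dμ(c)` (a real, nonnegative number),
for a Hermitian kernel. -/
theorem birChain_diag_eq (hk : Continuous (Function.uncurry k)) (hR : ∀ a b, ‖k a b‖ ≤ R)
    (hG0 : ∀ a b, G 0 a b = k a b) (hGs : ∀ n a b, G (n + 1) a b = ∫ c, G n a c * k c b ∂μ)
    (hherm : ∀ a b, k b a = conj (k a b)) (n : ℕ) (a : ι → ℝ) :
    G (2 * n + 1) a a = ((∫ c, ‖G n a c‖ ^ 2 ∂μ : ℝ) : ℂ) := by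
  rw [two_mul, birChain_add hk hR hG0 hGs n n a a, ← integral_complex_ofReal]
  refine integral_congr_ae (Filter.Eventually.of_forall fun c => ?_)
  show G n a c * G n c a = ((‖G n a c‖ ^ 2 : ℝ) : ℂ)
  rw [birChain_herm hk hR hG0 hGs hherm n a c, Complex.mul_conj']
  push_cast
  rfl

/-- Real part of the odd diagonal: `Re G (2n+1) a a = ∫ ‖G n a c‖² dμ(c)`. -/
theorem birChain_diag_re_eq (hk : Continuous (Function.uncurry k)) (hR : ∀ a b, ‖k a b‖ ≤ R)
    (hG0 : ∀ a b, G 0 a b = k a b) (hGs : ∀ n a b, G (n + 1) a b = ∫ c, G n a c * k c b ∂μ)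
    (hherm : ∀ a b, k b a = conj (k a b)) (n : ℕ) (a : ι → ℝ) :
    (G (2 * n + 1) a a).re = ∫ c, ‖G n a c‖ ^ 2 ∂μ := by
  rw [birChain_diag_eq hk hR hG0 hGs hherm n a, Complex.ofReal_re]

/-- The function `c ↦ ‖G n a c‖²` is continuous, nonnegative and integrable. -/
theorem birChain_normSq_integrable (hk : Continuous (Function.uncurry k)) (hR : ∀ a b, ‖k a b‖ ≤ R)
    (hG0 : ∀ a b, G 0 a b = k a b) (hGs : ∀ n a b, G (n + 1) a b = ∫ c, G n a c * k c b ∂μ)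
    (n : ℕ) (a : ι → ℝ) :
    Continuous (fun c => ‖G n a c‖ ^ 2) ∧ Integrable (fun c => ‖G n a c‖ ^ 2) μ := by
  have hc : Continuous (fun c => ‖G n a c‖ ^ 2) :=
    (((birChain_continuous hk hR hG0 hGs n).comp
      (continuous_const.prodMk continuous_id)).norm).pow 2
  refine ⟨hc, Integrable.of_bound hc.aestronglyMeasurable
    ((R ^ (n + 1) * (μ.real Set.univ) ^ n) ^ 2) (Filter.Eventually.of_forall fun c => ?_)⟩
  rw [Real.norm_of_nonneg (by positivity)]
  exact pow_le_pow_left₀ (norm_nonneg _) (birChain_norm_le hR hG0 hGs n a c) 2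

/-- Doubling step of the positivity chain: if `Re G n a a > 0` at a point `a` all of whose open
neighbourhoods have positive mass, then `Re G (2n+1) a a = ∫ ‖G n a c‖² dμ(c) > 0`. -/
theorem birChain_diag_re_pos_step (hk : Continuous (Function.uncurry k)) (hR : ∀ a b, ‖k a b‖ ≤ R)
    (hG0 : ∀ a b, G 0 a b = k a b) (hGs : ∀ n a b, G (n + 1) a b = ∫ c, G n a c * k c b ∂μ)
    (hherm : ∀ a b, k b a = conj (k a b)) {a : ι → ℝ}
    (ha : ∀ U : Set (ι → ℝ), IsOpen U → a ∈ U → 0 < μ U) (n : ℕ) (hn : 0 < (G n a a).re) :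
    0 < (G (2 * n + 1) a a).re := by
  rw [birChain_diag_re_eq hk hR hG0 hGs hherm n a]
  obtain ⟨hc, hi⟩ := birChain_normSq_integrable hk hR hG0 hGs n a
  rw [integral_pos_iff_support_of_nonneg (fun c => by positivity) hi]
  have hfa : 0 < ‖G n a a‖ ^ 2 := by
    have : 0 < ‖G n a a‖ := hn.trans_le (Complex.re_le_norm _)
    positivity
  set U : Set (ι → ℝ) := {c | ‖G n a a‖ ^ 2 / 2 < ‖G n a c‖ ^ 2} with hU
  have hUopen : IsOpen U := isOpen_lt continuous_const hc
  have haU : a ∈ U := by simp only [hU, Set.mem_setOf_eq]; linarith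
  have hUsupp : U ⊆ Function.support (fun c => ‖G n a c‖ ^ 2) := by
    intro c hcU
    simp only [hU, Set.mem_setOf_eq] at hcU
    simp only [Function.mem_support]
    intro h0
    rw [h0] at hcU
    linarith
  exact (ha U hUopen haU).trans_le (measure_mono hUsupp)

/-- Base of the positivity chain: `Re G 1 a a = ∫ ‖k a c‖² dμ(c) > 0` (the kernel vanishes
nowhere and `μ ≠ 0`). -/
theorem birChain_one_re_pos (hk : Continuous (Function.uncurry k)) (hR : ∀ a b, ‖k a b‖ ≤ R)
    (hG0 : ∀ a b, G 0 a b = k a b) (hGs : ∀ n a b, G (n + 1) a b = ∫ c, G n a c * k c b ∂μ)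
    (hherm : ∀ a b, k b a = conj (k a b)) (hne : ∀ a b, k a b ≠ 0) (hμ : 0 < μ Set.univ)
    (a : ι → ℝ) : 0 < (G 1 a a).re := by
  have h := birChain_diag_re_eq hk hR hG0 hGs hherm 0 a
  rw [Nat.mul_zero, Nat.zero_add] at h
  rw [h]
  obtain ⟨_, hi⟩ := birChain_normSq_integrable hk hR hG0 hGs 0 a
  rw [integral_pos_iff_support_of_nonneg (fun c => by positivity) hi]
  have hsupp : Function.support (fun c => ‖G 0 a c‖ ^ 2) = Set.univ := by
    ext c
    simp only [Function.mem_support, Set.mem_univ, iff_true]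
    have : G 0 a c ≠ 0 := by rw [hG0]; exact hne a c
    positivity
  rwa [hsupp]

/-- The doubling chain: `Re G (2^(t+1) - 1) a a > 0` for every `t` (`G 1 → G 3 → G 7 → …`). -/
theorem birChain_pow_re_pos (hk : Continuous (Function.uncurry k)) (hR : ∀ a b, ‖k a b‖ ≤ R)
    (hG0 : ∀ a b, G 0 a b = k a b) (hGs : ∀ n a b, G (n + 1) a b = ∫ c, G n a c * k c b ∂μ)
    (hherm : ∀ a b, k b a = conj (k a b)) (hne : ∀ a b, k a b ≠ 0) {a : ι → ℝ}
    (ha : ∀ U : Set (ι → ℝ), IsOpen U → a ∈ U → 0 < μ U) :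
    ∀ t : ℕ, 0 < (G (2 ^ (t + 1) - 1) a a).re := by
  intro t
  induction t with
  | zero =>
    have hμ : 0 < μ Set.univ := ha Set.univ isOpen_univ (Set.mem_univ a)
    simpa using birChain_one_re_pos hk hR hG0 hGs hherm hne hμ a
  | succ t ih =>
    have h := birChain_diag_re_pos_step hk hR hG0 hGs hherm ha (2 ^ (t + 1) - 1) ih
    have hidx : 2 * (2 ^ (t + 1) - 1) + 1 = 2 ^ (t + 1 + 1) - 1 := by
      have h1 : 1 ≤ 2 ^ (t + 1) := Nat.one_le_two_pow
      rw [pow_succ 2 (t + 1)]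
      omega
    rwa [hidx] at h

/-- Propagation of vanishing: if `G j a ·` vanishes `μ`-a.e. then `G (j+i+1) a a = 0` for all `i`
(semigroup law). -/
theorem birChain_diag_eq_zero_of_ae (hk : Continuous (Function.uncurry k)) (hR : ∀ a b, ‖k a b‖ ≤ R)
    (hG0 : ∀ a b, G 0 a b = k a b) (hGs : ∀ n a b, G (n + 1) a b = ∫ c, G n a c * k c b ∂μ)
    {j : ℕ} {a : ι → ℝ} (hj : ∀ᵐ c ∂μ, G j a c = 0) (i : ℕ) : G (j + i + 1) a a = 0 := by
  rw [birChain_add hk hR hG0 hGs j i a a]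
  refine integral_eq_zero_of_ae ?_
  filter_upwards [hj] with c hc
  simp [hc]

/-- **Strict positivity of the odd diagonal.** For a continuous, bounded, nowhere-vanishing
Hermitian kernel and a finite measure, `Re G (2n+1) a a = ∫ ‖G n a c‖² dμ(c) > 0` at every point
`a` all of whose open neighbourhoods have positive mass.  (If it vanished, `G n a ·` would vanish
a.e., hence `G N a a = 0` for all `N > n` by the semigroup law, contradicting the doubling chain at
`N = 2^(n+1) - 1`.) -/
theorem birChain_diag_re_pos (hk : Continuous (Function.uncurry k)) (hR : ∀ a b, ‖k a b‖ ≤ R)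
    (hG0 : ∀ a b, G 0 a b = k a b) (hGs : ∀ n a b, G (n + 1) a b = ∫ c, G n a c * k c b ∂μ)
    (hherm : ∀ a b, k b a = conj (k a b)) (hne : ∀ a b, k a b ≠ 0) {a : ι → ℝ}
    (ha : ∀ U : Set (ι → ℝ), IsOpen U → a ∈ U → 0 < μ U) (n : ℕ) :
    0 < (G (2 * n + 1) a a).re := by
  by_contra hneg
  push Not at hneg
  obtain ⟨_, hi⟩ := birChain_normSq_integrable hk hR hG0 hGs n a
  have hre := birChain_diag_re_eq hk hR hG0 hGs hherm n a
  have hnn : 0 ≤ ∫ c, ‖G n a c‖ ^ 2 ∂μ := integral_nonneg fun c => by positivity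
  have hzero : ∫ c, ‖G n a c‖ ^ 2 ∂μ = 0 := le_antisymm (hre ▸ hneg) hnn
  rw [integral_eq_zero_iff_of_nonneg (fun c => by positivity) hi] at hzero
  have hae : ∀ᵐ c ∂μ, G n a c = 0 := by
    filter_upwards [hzero] with c hc
    simpa using hc
  -- choose `i` with `n + i + 1 = 2^(n+1) - 1`
  have hlt : n + 2 ≤ 2 ^ (n + 1) := by
    have := Nat.lt_two_pow_self (n := n + 1)
    omega
  have hvan := birChain_diag_eq_zero_of_ae hk hR hG0 hGs hae (2 ^ (n + 1) - 1 - (n + 1))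
  have hidx : n + (2 ^ (n + 1) - 1 - (n + 1)) + 1 = 2 ^ (n + 1) - 1 := by omega
  rw [hidx] at hvan
  have hpos := birChain_pow_re_pos hk hR hG0 hGs hherm hne ha n
  rw [hvan] at hpos
  simp at hpos

/-- **Positivity of the odd traces.** If `μ`-almost every point has all its open neighbourhoods
of positive mass (e.g. Lebesgue measure restricted to a box) and `μ ≠ 0`, then
`∫ G (2n+1) a a dμ(a)` is a real number `> 0` — the path-integral form of
`Tr T^(2n+2) = ‖T^(n+1)‖²_HS > 0` for the Hermitian Hilbert–Schmidt operator with kernel `k`. -/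
theorem birChain_integral_diag_pos (hk : Continuous (Function.uncurry k)) (hR : ∀ a b, ‖k a b‖ ≤ R)
    (hG0 : ∀ a b, G 0 a b = k a b) (hGs : ∀ n a b, G (n + 1) a b = ∫ c, G n a c * k c b ∂μ)
    (hherm : ∀ a b, k b a = conj (k a b)) (hne : ∀ a b, k a b ≠ 0) {S : Set (ι → ℝ)}
    (hS : ∀ a ∈ S, ∀ U : Set (ι → ℝ), IsOpen U → a ∈ U → 0 < μ U) (hSae : ∀ᵐ a ∂μ, a ∈ S)
    (hμ : 0 < μ Set.univ) (n : ℕ) :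
    ∫ a, G (2 * n + 1) a a ∂μ = ((∫ a, (G (2 * n + 1) a a).re ∂μ : ℝ) : ℂ) ∧
      0 < ∫ a, (G (2 * n + 1) a a).re ∂μ := by
  have hdiag : ∀ a, G (2 * n + 1) a a = (((G (2 * n + 1) a a).re : ℝ) : ℂ) := by
    intro a
    rw [birChain_diag_re_eq hk hR hG0 hGs hherm n a]
    exact birChain_diag_eq hk hR hG0 hGs hherm n a
  refine ⟨?_, ?_⟩
  · rw [← integral_complex_ofReal]
    exact integral_congr_ae (Filter.Eventually.of_forall hdiag)
  · -- the real diagonal is continuous, bounded, nonnegative, and positive on `S`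
    have hc : Continuous (fun a => (G (2 * n + 1) a a).re) :=
      Complex.continuous_re.comp ((birChain_continuous hk hR hG0 hGs (2 * n + 1)).comp
        (continuous_id.prodMk continuous_id))
    have hi : Integrable (fun a => (G (2 * n + 1) a a).re) μ := by
      refine Integrable.of_bound hc.aestronglyMeasurable
        (R ^ (2 * n + 1 + 1) * (μ.real Set.univ) ^ (2 * n + 1))
        (Filter.Eventually.of_forall fun a => ?_)
      exact ((RCLike.norm_re_le_norm (K := ℂ) _).trans (birChain_norm_le hR hG0 hGs _ a a))
    have hnn : ∀ a, 0 ≤ (G (2 * n + 1) a a).re := by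
      intro a
      rw [birChain_diag_re_eq hk hR hG0 hGs hherm n a]
      exact integral_nonneg fun c => by positivity
    rw [integral_pos_iff_support_of_nonneg hnn hi]
    have hsub : S ⊆ Function.support (fun a => (G (2 * n + 1) a a).re) := fun a haS =>
      (birChain_diag_re_pos hk hR hG0 hGs hherm hne (hS a haS) n).ne'
    have hc0 : μ Sᶜ = 0 := ae_iff.mp hSae
    have hSfull : μ Set.univ ≤ μ S := by
      calc μ Set.univ = μ (S ∪ Sᶜ) := by rw [Set.union_compl_self]
        _ ≤ μ S + μ Sᶜ := measure_union_le S Sᶜ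
        _ = μ S := by rw [hc0, add_zero]
    exact hμ.trans_le (hSfull.trans (measure_mono hsub))

end ChainKernel

end Summit.HubbardSuperconductivity.HubbardSuperconductivity.Theorems
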